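import Summits.CriticalPhenomena.PercolationContinuityZ3.Theorems.PercNearOneGluingNoHeavyLowerTailForestRayleighContractPin
import Summits.CriticalPhenomena.PercolationContinuityZ3.Theorems.PercNearOneGluingNoHeavyLowerTailForestRayleighDispatch
import HarnessLib

/-!
# Weighted forest negative correlation — contraction IV: the steps for a free edge `vx` and for a Rayleigh edge `vx`

Continuation of `…ContractPin` (same notation and hypotheses; `uv ∈ K` pinned, `x ≠ u, v`):
`lsm_contract_step_free` (`vx ∈ D`: re-route / merge / drop / cancel against the Rayleigh edge `ux`)
and `lsm_contract_step_rayleigh` (`vx = e`: re-route the Rayleigh edge to `ux`, possibly after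
cancelling a free `ux`; trivial if `ux` is pinned or `= f`). Theorems only; no definitions, no `sorry`.
-/

open Finset SimpleGraph
open scoped Classical

namespace Summit.CriticalPhenomena.PercolationContinuityZ3.Theorems.ForestRayleigh

variable {V : Type*} [Fintype V] [DecidableEq V]

/-- **Contraction step, `vx` free.** -/
theorem lsm_contract_step_free (R₀ : Finset (Sym2 V)) (u v : V) (huv : u ≠ v) (n : ℕ)
    (ih : ∀ (w : Sym2 V → ℝ), (∀ x, 0 ≤ w x) → ∀ (D K : Finset (Sym2 V)) (e f : Sym2 V),
        Disjoint D K → e ∉ D → e ∉ K → f ∉ D → f ∉ K → e ≠ f → s(v, u) ∈ K →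
        (∀ z ∈ D ∪ insert e (insert f K), ¬z.IsDiag) →
        (∀ z ∈ D ∪ insert e (insert f K), v ∉ z → z ∈ R₀) →
        (∀ y, s(v, y) ∈ D ∪ insert e (insert f K) → y ≠ u → s(u, y) ∈ R₀) →
        ((D ∪ insert e (insert f K)).filter (fun z => v ∈ z)).card ≤ n + 1 →
        (∑ G ∈ D.powerset.filter (fun G =>
        (fromEdgeSet ((G ∪ (insert e (insert f (K))) : Finset (Sym2 V)) : Set (Sym2 V))).IsAcyclic), ∏ y ∈ G, w y) *
          (∑ G ∈ D.powerset.filter (fun G =>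
        (fromEdgeSet ((G ∪ (K) : Finset (Sym2 V)) : Set (Sym2 V))).IsAcyclic), ∏ y ∈ G, w y) ≤
        (∑ G ∈ D.powerset.filter (fun G =>
        (fromEdgeSet ((G ∪ (insert e (K)) : Finset (Sym2 V)) : Set (Sym2 V))).IsAcyclic), ∏ y ∈ G, w y) *
          (∑ G ∈ D.powerset.filter (fun G =>
        (fromEdgeSet ((G ∪ (insert f (K)) : Finset (Sym2 V)) : Set (Sym2 V))).IsAcyclic), ∏ y ∈ G, w y))
    (w : Sym2 V → ℝ) (hw : ∀ x, 0 ≤ w x) (D K : Finset (Sym2 V)) (e f : Sym2 V)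
    (hDK : Disjoint D K) (heD : e ∉ D) (heK : e ∉ K) (hfD : f ∉ D) (hfK : f ∉ K) (hef : e ≠ f)
    (huvK : s(v, u) ∈ K) (hL : ∀ z ∈ D ∪ insert e (insert f K), ¬z.IsDiag)
    (hR : ∀ z ∈ D ∪ insert e (insert f K), v ∉ z → z ∈ R₀)
    (hrr : ∀ y, s(v, y) ∈ D ∪ insert e (insert f K) → y ≠ u → s(u, y) ∈ R₀)
    (hcard : ((D ∪ insert e (insert f K)).filter (fun z => v ∈ z)).card ≤ n + 1 + 1)
    {x : V} (hxu : x ≠ u) (hxv : v ≠ x)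
    (hgD : s(v, x) ∈ D) :
    (∑ G ∈ D.powerset.filter (fun G =>
        (fromEdgeSet ((G ∪ (insert e (insert f (K))) : Finset (Sym2 V)) : Set (Sym2 V))).IsAcyclic), ∏ y ∈ G, w y) *
      (∑ G ∈ D.powerset.filter (fun G =>
        (fromEdgeSet ((G ∪ (K) : Finset (Sym2 V)) : Set (Sym2 V))).IsAcyclic), ∏ y ∈ G, w y) ≤
    (∑ G ∈ D.powerset.filter (fun G =>
        (fromEdgeSet ((G ∪ (insert e (K)) : Finset (Sym2 V)) : Set (Sym2 V))).IsAcyclic), ∏ y ∈ G, w y) *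
      (∑ G ∈ D.powerset.filter (fun G =>
        (fromEdgeSet ((G ∪ (insert f (K)) : Finset (Sym2 V)) : Set (Sym2 V))).IsAcyclic), ∏ y ∈ G, w y) := by
  have hux : u ≠ x := fun h => hxu h.symm
  have hvu : v ≠ u := fun h => huv h.symm
  have hg'd : ¬(s(u, x)).IsDiag := fun h => hux (Sym2.mk_isDiag_iff.1 h)
  have hvg' : v ∉ s(u, x) := by rw [Sym2.mem_iff, not_or]; exact ⟨hvu, hxv⟩
  have hvg : v ∈ s(v, x) := Sym2.mem_mk_left _ _
  have hgE : s(v, x) ∈ D ∪ insert e (insert f K) := Finset.mem_union_left _ hgD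
  have hg'R : s(u, x) ∈ R₀ := hrr x hgE hxu
  have hne : s(v, x) ≠ s(u, x) := fun h => hvg' (h ▸ hvg)
  have hgK : s(v, x) ∉ K := fun h => Finset.disjoint_left.1 hDK hgD h
  have hge : s(v, x) ≠ e := fun h => heD (h ▸ hgD)
  have hgf : s(v, x) ≠ f := fun h => hfD (h ▸ hgD)
  set D₁ := D.erase s(v, x) with hD₁
  have hDeq : D = insert s(v, x) D₁ := (Finset.insert_erase hgD).symm
  have hgD₁ : s(v, x) ∉ D₁ := Finset.notMem_erase _ _
  have hD₁D : D₁ ⊆ D := Finset.erase_subset _ _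
  have hsubE₁ : D₁ ∪ insert e (insert f K) ⊆ D ∪ insert e (insert f K) :=
    Finset.union_subset_union hD₁D subset_rfl
  have hL₁ : ∀ z ∈ D₁ ∪ insert e (insert f K), ¬z.IsDiag := fun z hz => hL z (hsubE₁ hz)
  have hDK₁ : Disjoint D₁ K := Finset.disjoint_of_subset_left hD₁D hDK
  have h₁ : s(v, x) ∉ D₁ ∪ insert e (insert f K) := by
    simp only [Finset.mem_union, Finset.mem_insert, not_or]; exact ⟨hgD₁, hge, hgf, hgK⟩
  by_cases h'K : s(u, x) ∈ K
  · -- `vx` closes the pinned path `x u v`: drop it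
    have hgE' : s(v, x) ∉ D₁ ∪ insert e (insert f K) := h₁
    obtain ⟨hL', hR', hrr', hcard'⟩ := contract_transfer ((hsubE₁).trans (Finset.subset_insert _ _))
      hg'R hg'd hvg' hgE hgE' hvg hL hR hrr hcard
    rw [hDeq]
    refine lsm_free_closing w D₁ K e f s(v, x) hgD₁ ?_ (ih w hw D₁ K e f hDK₁ (fun h => heD (hD₁D h))
      heK (fun h => hfD (hD₁D h)) hfK hef huvK hL' hR' hrr' hcard')
    exact not_isAcyclic_of_triangle (X := insert s(v, x) K) (a := v) (b := u) (c := x)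
      (by
        intro z hz
        rcases Finset.mem_insert.1 hz with rfl | hz
        · exact fun h => hxv (Sym2.mk_isDiag_iff.1 h)
        · exact hL z (by simp [hz]))
      (Finset.mem_insert_of_mem huvK) (Finset.mem_insert_of_mem h'K) (Finset.mem_insert_self _ _)
      hvu hux hxv
  by_cases h'e : s(u, x) = e
  · -- `ux = e`: the free `vx` is parallel to the Rayleigh edge and cancels
    subst h'e
    have hgE' : s(v, x) ∉ D₁ ∪ insert s(u, x) (insert f K) := h₁
    obtain ⟨hL', hR', hrr', hcard'⟩ := contract_transfer ((hsubE₁).trans (Finset.subset_insert _ _))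
      hg'R hg'd hvg' hgE hgE' hvg hL hR hrr hcard
    have hLf : ∀ z ∈ D₁ ∪ insert f K, ¬z.IsDiag := fun z hz => hL₁ z (by
      simp only [Finset.mem_union, Finset.mem_insert] at hz ⊢; tauto)
    rw [hDeq]
    refine lsm_free_parallel_rayleigh w hw D₁ K f hLf (u := v) (v := u) (x := x)
      (by rw [Sym2.eq_swap]; exact huvK) hux hxv ?_ ?_ (ih w hw D₁ K s(u, x) f hDK₁ (fun h => heD (hD₁D h))
      heK (fun h => hfD (hD₁D h)) hfK hef huvK hL' hR' hrr' hcard')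
    · simp only [Finset.mem_union, Finset.mem_insert, not_or]
      exact ⟨fun h => heD (hD₁D h), hef, heK⟩
    · simp only [Finset.mem_union, Finset.mem_insert, not_or]; exact ⟨hgD₁, hgf, hgK⟩
  by_cases h'f : s(u, x) = f
  · subst h'f
    have hgE' : s(v, x) ∉ D₁ ∪ insert s(u, x) (insert e K) := by
      simp only [Finset.mem_union, Finset.mem_insert, not_or]; exact ⟨hgD₁, hgf, hge, hgK⟩
    have hsub2 : D₁ ∪ insert s(u, x) (insert e K) ⊆ insert s(u, x) (D ∪ insert e (insert s(u, x) K)) := by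
      intro z hz; simp only [Finset.mem_union, Finset.mem_insert] at hz ⊢
      rcases hz with h | h | h | h
      · exact Or.inr (Or.inl (hD₁D h))
      · exact Or.inl h
      · exact Or.inr (Or.inr (Or.inl h))
      · exact Or.inr (Or.inr (Or.inr (Or.inr h)))
    have hcard2 : ((D ∪ insert e (insert s(u, x) K)).filter (fun z => v ∈ z)).card ≤ n + 1 + 1 := hcard
    obtain ⟨hL', hR', hrr', hcard'⟩ := contract_transfer hsub2 hg'R hg'd hvg' hgE hgE' hvg hL hR hrr hcard2
    have hLe : ∀ z ∈ D₁ ∪ insert e K, ¬z.IsDiag := fun z hz => hL₁ z (by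
      simp only [Finset.mem_union, Finset.mem_insert] at hz ⊢; tauto)
    rw [hDeq]
    apply lsm_symm
    refine lsm_free_parallel_rayleigh w hw D₁ K e hLe (u := v) (v := u) (x := x)
      (by rw [Sym2.eq_swap]; exact huvK) hux hxv ?_ ?_ (ih w hw D₁ K s(u, x) e hDK₁ (fun h => hfD (hD₁D h))
      hfK (fun h => heD (hD₁D h)) heK hef.symm huvK hL' hR' hrr' hcard')
    · simp only [Finset.mem_union, Finset.mem_insert, not_or]
      exact ⟨fun h => hfD (hD₁D h), hef.symm, hfK⟩
    · simp only [Finset.mem_union, Finset.mem_insert, not_or]; exact ⟨hgD₁, hge, hgK⟩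
  by_cases h'D : s(u, x) ∈ D
  · -- two parallel free edges: merge
    set D₂ := D₁.erase s(u, x) with hD₂
    have hg'D₁ : s(u, x) ∈ D₁ := Finset.mem_erase.2 ⟨hne.symm, h'D⟩
    have hD₁eq : D₁ = insert s(u, x) D₂ := (Finset.insert_erase hg'D₁).symm
    have hD₂D : D₂ ⊆ D := (Finset.erase_subset _ _).trans hD₁D
    have hg'D₂ : s(u, x) ∉ D₂ := Finset.notMem_erase _ _
    have hgD₂ : s(v, x) ∉ D₂ := fun h => hgD₁ (Finset.mem_of_mem_erase h)
    have hL₂ : ∀ z ∈ D₂ ∪ insert e (insert f K), ¬z.IsDiag := fun z hz =>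
      hL z (Finset.union_subset_union hD₂D subset_rfl hz)
    have hsub' : insert s(u, x) D₂ ∪ insert e (insert f K) ⊆ insert s(u, x) (D ∪ insert e (insert f K)) := by
      intro z hz; simp only [Finset.mem_union, Finset.mem_insert] at hz ⊢
      rcases hz with (h | h) | h
      · exact Or.inl h
      · exact Or.inr (Or.inl (hD₂D h))
      · exact Or.inr (Or.inr h)
    have hgE' : s(v, x) ∉ insert s(u, x) D₂ ∪ insert e (insert f K) := by
      simp only [Finset.mem_union, Finset.mem_insert, not_or]; exact ⟨⟨hne, hgD₂⟩, hge, hgf, hgK⟩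
    obtain ⟨hL', hR', hrr', hcard'⟩ := contract_transfer hsub' hg'R hg'd hvg' hgE hgE' hvg hL hR hrr hcard
    have hw' : ∀ y, 0 ≤ Function.update w s(u, x) (w s(u, x) + w s(v, x)) y := update_nonneg w hw _ (add_nonneg (hw _) (hw _))
    rw [hDeq, hD₁eq]
    refine lsm_free_merge w D₂ K e f hL₂ huvK hxv hux ?_ ?_ (ih _ hw' (insert s(u, x) D₂) K e f
      (Finset.disjoint_insert_left.2 ⟨h'K, Finset.disjoint_of_subset_left hD₂D hDK⟩)
      (by rw [Finset.mem_insert, not_or]; exact ⟨fun h => h'e h.symm, fun h => heD (hD₂D h)⟩) heK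
      (by rw [Finset.mem_insert, not_or]; exact ⟨fun h => h'f h.symm, fun h => hfD (hD₂D h)⟩) hfK
      hef huvK hL' hR' hrr' hcard')
    · simp only [Finset.mem_union, Finset.mem_insert, not_or]; exact ⟨hgD₂, hge, hgf, hgK⟩
    · simp only [Finset.mem_union, Finset.mem_insert, not_or]; exact ⟨hg'D₂, h'e, h'f, h'K⟩
  · -- `ux` fresh: re-route the free edge
    have h₂ : s(u, x) ∉ D₁ ∪ insert e (insert f K) := by
      simp only [Finset.mem_union, Finset.mem_insert, not_or]
      exact ⟨fun h => h'D (hD₁D h), h'e, h'f, h'K⟩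
    have hsub' : insert s(u, x) D₁ ∪ insert e (insert f K) ⊆ insert s(u, x) (D ∪ insert e (insert f K)) := by
      intro z hz; simp only [Finset.mem_union, Finset.mem_insert] at hz ⊢
      rcases hz with (h | h) | h
      · exact Or.inl h
      · exact Or.inr (Or.inl (hD₁D h))
      · exact Or.inr (Or.inr h)
    have hgE' : s(v, x) ∉ insert s(u, x) D₁ ∪ insert e (insert f K) := by
      simp only [Finset.mem_union, Finset.mem_insert, not_or]; exact ⟨⟨hne, hgD₁⟩, hge, hgf, hgK⟩
    obtain ⟨hL', hR', hrr', hcard'⟩ := contract_transfer hsub' hg'R hg'd hvg' hgE hgE' hvg hL hR hrr hcard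
    have hw' : ∀ y, 0 ≤ Function.update w s(u, x) (w s(v, x)) y := update_nonneg w hw _ (hw _)
    rw [hDeq]
    exact lsm_free_reroute w D₁ K e f hL₁ huvK hxv hux h₁ h₂ (ih _ hw' (insert s(u, x) D₁) K e f
      (Finset.disjoint_insert_left.2 ⟨h'K, hDK₁⟩)
      (by rw [Finset.mem_insert, not_or]; exact ⟨fun h => h'e h.symm, fun h => heD (hD₁D h)⟩) heK
      (by rw [Finset.mem_insert, not_or]; exact ⟨fun h => h'f h.symm, fun h => hfD (hD₁D h)⟩) hfK
      hef huvK hL' hR' hrr' hcard')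

/-- **Contraction step, `vx = e` a Rayleigh edge.** -/
theorem lsm_contract_step_rayleigh (R₀ : Finset (Sym2 V)) (u v : V) (huv : u ≠ v) (n : ℕ)
    (ih : ∀ (w : Sym2 V → ℝ), (∀ x, 0 ≤ w x) → ∀ (D K : Finset (Sym2 V)) (e f : Sym2 V),
        Disjoint D K → e ∉ D → e ∉ K → f ∉ D → f ∉ K → e ≠ f → s(v, u) ∈ K →
        (∀ z ∈ D ∪ insert e (insert f K), ¬z.IsDiag) →
        (∀ z ∈ D ∪ insert e (insert f K), v ∉ z → z ∈ R₀) →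
        (∀ y, s(v, y) ∈ D ∪ insert e (insert f K) → y ≠ u → s(u, y) ∈ R₀) →
        ((D ∪ insert e (insert f K)).filter (fun z => v ∈ z)).card ≤ n + 1 →
        (∑ G ∈ D.powerset.filter (fun G =>
        (fromEdgeSet ((G ∪ (insert e (insert f (K))) : Finset (Sym2 V)) : Set (Sym2 V))).IsAcyclic), ∏ y ∈ G, w y) *
          (∑ G ∈ D.powerset.filter (fun G =>
        (fromEdgeSet ((G ∪ (K) : Finset (Sym2 V)) : Set (Sym2 V))).IsAcyclic), ∏ y ∈ G, w y) ≤
        (∑ G ∈ D.powerset.filter (fun G =>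
        (fromEdgeSet ((G ∪ (insert e (K)) : Finset (Sym2 V)) : Set (Sym2 V))).IsAcyclic), ∏ y ∈ G, w y) *
          (∑ G ∈ D.powerset.filter (fun G =>
        (fromEdgeSet ((G ∪ (insert f (K)) : Finset (Sym2 V)) : Set (Sym2 V))).IsAcyclic), ∏ y ∈ G, w y))
    (w : Sym2 V → ℝ) (hw : ∀ x, 0 ≤ w x) (D K : Finset (Sym2 V)) {x : V} (f : Sym2 V)
    (hDK : Disjoint D K) (heD : s(v, x) ∉ D) (heK : s(v, x) ∉ K) (hfD : f ∉ D) (hfK : f ∉ K)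
    (hef : s(v, x) ≠ f) (huvK : s(v, u) ∈ K) (hL : ∀ z ∈ D ∪ insert s(v, x) (insert f K), ¬z.IsDiag)
    (hR : ∀ z ∈ D ∪ insert s(v, x) (insert f K), v ∉ z → z ∈ R₀)
    (hrr : ∀ y, s(v, y) ∈ D ∪ insert s(v, x) (insert f K) → y ≠ u → s(u, y) ∈ R₀)
    (hcard : ((D ∪ insert s(v, x) (insert f K)).filter (fun z => v ∈ z)).card ≤ n + 1 + 1)
    (hxu : x ≠ u) (hxv : v ≠ x) :
    (∑ G ∈ D.powerset.filter (fun G =>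
        (fromEdgeSet ((G ∪ (insert s(v, x) (insert f (K))) : Finset (Sym2 V)) : Set (Sym2 V))).IsAcyclic), ∏ y ∈ G, w y) *
      (∑ G ∈ D.powerset.filter (fun G =>
        (fromEdgeSet ((G ∪ (K) : Finset (Sym2 V)) : Set (Sym2 V))).IsAcyclic), ∏ y ∈ G, w y) ≤
    (∑ G ∈ D.powerset.filter (fun G =>
        (fromEdgeSet ((G ∪ (insert s(v, x) (K)) : Finset (Sym2 V)) : Set (Sym2 V))).IsAcyclic), ∏ y ∈ G, w y) *
      (∑ G ∈ D.powerset.filter (fun G =>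
        (fromEdgeSet ((G ∪ (insert f (K)) : Finset (Sym2 V)) : Set (Sym2 V))).IsAcyclic), ∏ y ∈ G, w y) := by
  have hux : u ≠ x := fun h => hxu h.symm
  have hvu : v ≠ u := fun h => huv h.symm
  have hg'd : ¬(s(u, x)).IsDiag := fun h => hux (Sym2.mk_isDiag_iff.1 h)
  have hvg' : v ∉ s(u, x) := by rw [Sym2.mem_iff, not_or]; exact ⟨hvu, hxv⟩
  have hvg : v ∈ s(v, x) := Sym2.mem_mk_left _ _
  have hgE : s(v, x) ∈ D ∪ insert s(v, x) (insert f K) := by simp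
  have hg'R : s(u, x) ∈ R₀ := hrr x hgE hxu
  have hne : s(v, x) ≠ s(u, x) := fun h => hvg' (h ▸ hvg)
  by_cases h'K : s(u, x) ∈ K
  · exact lsm_of_pinned_triangle w hw D K s(v, x) f hL huv hxv hux (by simp [huvK]) (by simp) (by simp [h'K])
  by_cases h'f : s(u, x) = f
  · exact lsm_of_pinned_triangle w hw D K s(v, x) f hL huv hxv hux (by simp [huvK]) (by simp) (by simp [h'f])
  -- re-routing `e` to `ux`, for any free set `D' ⊆ D` avoiding `ux`
  have core : ∀ D' : Finset (Sym2 V), D' ⊆ D → s(u, x) ∉ D' →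
      (∑ G ∈ D'.powerset.filter (fun G =>
        (fromEdgeSet ((G ∪ (insert s(v, x) (insert f (K))) : Finset (Sym2 V)) : Set (Sym2 V))).IsAcyclic), ∏ y ∈ G, w y) *
        (∑ G ∈ D'.powerset.filter (fun G =>
        (fromEdgeSet ((G ∪ (K) : Finset (Sym2 V)) : Set (Sym2 V))).IsAcyclic), ∏ y ∈ G, w y) ≤
      (∑ G ∈ D'.powerset.filter (fun G =>
        (fromEdgeSet ((G ∪ (insert s(v, x) (K)) : Finset (Sym2 V)) : Set (Sym2 V))).IsAcyclic), ∏ y ∈ G, w y) *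
        (∑ G ∈ D'.powerset.filter (fun G =>
        (fromEdgeSet ((G ∪ (insert f (K)) : Finset (Sym2 V)) : Set (Sym2 V))).IsAcyclic), ∏ y ∈ G, w y) := by
    intro D' hD'D h'D'
    have hDK' : Disjoint D' K := Finset.disjoint_of_subset_left hD'D hDK
    have hLf : ∀ z ∈ D' ∪ insert f K, ¬z.IsDiag := fun z hz => hL z (by
      simp only [Finset.mem_union, Finset.mem_insert] at hz ⊢
      rcases hz with h | h | h
      · exact Or.inl (hD'D h)
      · exact Or.inr (Or.inr (Or.inl h))
      · exact Or.inr (Or.inr (Or.inr h)))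
    have h₁ : s(v, x) ∉ D' ∪ insert f K := by
      simp only [Finset.mem_union, Finset.mem_insert, not_or]; exact ⟨fun h => heD (hD'D h), hef, heK⟩
    have h₂ : s(u, x) ∉ D' ∪ insert f K := by
      simp only [Finset.mem_union, Finset.mem_insert, not_or]; exact ⟨h'D', h'f, h'K⟩
    have hsub' : D' ∪ insert s(u, x) (insert f K) ⊆ insert s(u, x) (D ∪ insert s(v, x) (insert f K)) := by
      intro z hz; simp only [Finset.mem_union, Finset.mem_insert] at hz ⊢
      rcases hz with h | h | h | h
      · exact Or.inr (Or.inl (hD'D h))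
      · exact Or.inl h
      · exact Or.inr (Or.inr (Or.inr (Or.inl h)))
      · exact Or.inr (Or.inr (Or.inr (Or.inr h)))
    have hgE' : s(v, x) ∉ D' ∪ insert s(u, x) (insert f K) := by
      simp only [Finset.mem_union, Finset.mem_insert, not_or]; exact ⟨fun h => heD (hD'D h), hne, hef, heK⟩
    obtain ⟨hL', hR', hrr', hcard'⟩ := contract_transfer hsub' hg'R hg'd hvg' hgE hgE' hvg hL hR hrr hcard
    exact lsm_rayleigh_reroute w D' K f hLf huvK hxv hux h₁ h₂ (ih w hw D' K s(u, x) f hDK' h'D' h'K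
      (fun h => hfD (hD'D h)) hfK (fun h => h'f h) (huvK) hL' hR' hrr' hcard')
  by_cases h'D : s(u, x) ∈ D
  · -- a free `ux` parallel to the Rayleigh edge `vx` cancels first
    have hD₁D : D.erase s(u, x) ⊆ D := Finset.erase_subset _ _
    have hLf : ∀ z ∈ D.erase s(u, x) ∪ insert f K, ¬z.IsDiag := fun z hz => hL z (by
      simp only [Finset.mem_union, Finset.mem_insert, Finset.mem_erase] at hz ⊢
      rcases hz with h | h | h
      · exact Or.inl h.2
      · exact Or.inr (Or.inr (Or.inl h))
      · exact Or.inr (Or.inr (Or.inr h)))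
    rw [show D = insert s(u, x) (D.erase s(u, x)) from (Finset.insert_erase h'D).symm]
    refine lsm_free_parallel_rayleigh w hw (D.erase s(u, x)) K f hLf huvK hxv hux ?_ ?_
      (core _ hD₁D (Finset.notMem_erase _ _))
    · simp only [Finset.mem_union, Finset.mem_insert, Finset.mem_erase, not_or]
      exact ⟨fun h => heD h.2, hef, heK⟩
    · simp only [Finset.mem_union, Finset.mem_insert, Finset.mem_erase, not_or]
      exact ⟨fun h => h.1 rfl, h'f, h'K⟩
  · exact core D subset_rfl h'D

end Summit.CriticalPhenomena.PercolationContinuityZ3.Theorems.ForestRayleigh
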